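import Summits.QuantumFields.YangMills.Theorems.UnitScaleTiltProp7CornerCombL1Engine
import HarnessLib

/-!
# (n3)-COMB (II), row `hMcomb₂`, located difficulty H2-1 — THE `ℓ¹` ENGINE, SCALED CORNER READING (companion of ✓p710753 `…CornerCombL1Engine`)

Crux `stmt-QuantumFields-19200` `MinimiserStabilityRegPr`, route-R E′ (A′)-on-Σ, P-A2 (β).  Width seat `ym3-torus-px18` (gen 4); `--kind proof --supports stmt-QuantumFields-19200 --as helper`;
THEOREMS ONLY; «(O2) groundwork — not consumed by any displayed row before the freeze lifts»; count-neutral.  YM₃ on T³ is a ladder rung (R3), not Clay; nothing here is progress on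
the YM mass gap.

THE POINT.  ✓p710753 `sum_norm_le_localised_of_pointwise` phrases the tree-step bound of the corner value `CM_i(G_i) y` and the top of the reading chain `U i w` with the tree words
walked FROM `y` ∕ `w`.  ✓p704390 `cornerComb_structure`'s corner maps are `CM k G z := FhatCov L Ūᵏ G (L•z)` — they read the block at the LEVEL-`k` site `L•z` (✓p711222
`norm_FhatCov_le_sum_steps` gives the bound with steps from `L•y`).  This file restates the row with the tree words walked from `L•y` ∕ `L•w`; the proof is the same chain
(`le_localised_of_steps_bound` at `L•y`).  One theorem: ★★★ `sum_norm_le_localised_of_pointwise_scaled`.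
HONEST: finite-sum bookkeeping; nothing of H2-1's member ∕ `hMcomb₂` ∕ `hMcomb` ∕ (β) ∕ the crux is proved or claimed; rung R3 (YM₃ on T³), NOT d = 4, NOT Clay; YM gap NOT proved.
References: T. Bałaban, CMP 98 (1985) 17–51 [Balaban1985Averaging] ((42)–(43) pp.23–24, (112) p.34, (125) p.36).
-/

set_option autoImplicit false

open scoped BigOperators
open Finset
open Literature.MathematicalPhysics.QuantumFieldTheory.Balaban1983to89.B7Prop1Explicit
open Summit.QuantumFields.YangMills.Theorems.Prop7CornerCombL1Engine

namespace Summit.QuantumFields.YangMills.Theorems.Prop7CornerCombL1EngineScaled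

variable {d : ℕ} {𝔸 : Type*} [SeminormedAddCommGroup 𝔸]

/-- ★★★ **THE LOCALISED `ℓ¹` ROW, SCALED CORNER READING** (v1.1; the form ✓p704390's corner maps need): identical to `sum_norm_le_localised_of_pointwise` except that the
tree-step bound of `CM_i(G_i) y` and the top of the reading chain `U i w` sit at the level-`i` site `L•y` ∕ `L•w` (where `FhatCov L Ūⁱ (G i) (L•y)` actually reads), not at `y` ∕ `w`:
`hC : ‖CM i (G i) y‖ ≤ Σ_r L⁻ᵈ·Σ_{steps of treeWord r from L•y}‖G i (step)‖`, `hUtop : those step sites ∈ U i w i`.  Conclusion unchanged: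
`Σ_{z∈Zk}Σ_κ‖Q z κ‖ ≤ (Π_{m<k}w_m)·Σ_{Z 0}Σ_ν‖G 0‖ + d·L·Σ_{i<k}(Π_{m<i}w_m)·Σ_{z∈Zk}Σ_κ(Σ_{x∈U i (L^{k−1−i}•z) 0}Σ_μ‖G 0 x μ‖ + Σ_{x∈U i (L^{k−1−i}•(z+e κ)) 0}Σ_μ‖G 0 x μ‖)`.
«(O2) groundwork.» [cite: Balaban1985Averaging, (42)–(43) pp.23–24, (112) p.34, (125) p.36] -/
theorem sum_norm_le_localised_of_pointwise_scaled (L : ℕ) (hL : 1 ≤ L) (G : ℕ → Site d → Fin d → 𝔸) (a : ℕ → ℝ) (ha : ∀ m, 0 ≤ a m)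
    (CM : ℕ → (Site d → Fin d → 𝔸) → Site d → 𝔸) (Λ : ℕ → Site d → 𝔸) (hΛ0 : ∀ z, Λ 0 z = 0)
    (hΛs : ∀ (k : ℕ) (z : Site d), Λ (k + 1) z = CM k (G k) z + Λ k ((L : ℤ) • z))
    (k : ℕ) (Q : Site d → Fin d → 𝔸) (Zk : Finset (Site d))
    (hQ : ∀ z ∈ Zk, ∀ κ : Fin d, ‖Q z κ‖ ≤ ‖G k z κ‖ + ‖Λ k z‖ + ‖Λ k (z + e κ)‖)
    (hpt : ∀ m, m < k → ∀ (z : Site d) (κ : Fin d), ‖G (m + 1) z κ‖ ≤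
      ((L : ℝ) ^ d)⁻¹ * ∑ r : Fin d → Fin L, ∑ t ∈ Finset.range L, ‖G m ((L : ℤ) • z + boxVec L r + (t : ℤ) • e κ) κ‖ +
        a m * ∑ s : Fin d → Fin L, ∑ ν : Fin d, (‖G m ((L : ℤ) • z + boxVec L s) ν‖ + ‖G m ((L : ℤ) • z + (L : ℤ) • e κ + boxVec L s) ν‖))
    (hC : ∀ i, i < k → ∀ (y : Site d), ‖CM i (G i) y‖ ≤ ∑ r : Fin d → Fin L, ((L : ℝ) ^ d)⁻¹ *
      ((List.zip (List.scanl (fun (z : Site d) (l' : Letter d) => z + l'.vec) ((L : ℤ) • y) (treeWord (boxVec L r))) (treeWord (boxVec L r))).map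
        fun s => ‖G i s.1 s.2.1‖).sum)
    (Z : ℕ → Finset (Site d)) (hZk : Z k = Zk)
    (hZ : ∀ m, m < k → ∀ z ∈ Z (m + 1), ∀ (κ : Fin d) (r : Fin d → Fin L) (t : ℕ), t < L → (L : ℤ) • z + boxVec L r + (t : ℤ) • e κ ∈ Z m)
    (hZ' : ∀ m, m < k → ∀ z ∈ Z (m + 1), ∀ (κ : Fin d) (s : Fin d → Fin L), (L : ℤ) • z + (L : ℤ) • e κ + boxVec L s ∈ Z m)
    (U : ℕ → Site d → ℕ → Finset (Site d))
    (hUtop : ∀ i, i < k → ∀ (w : Site d) (r : Fin d → Fin L),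
      ∀ s ∈ List.zip (List.scanl (fun (z : Site d) (l' : Letter d) => z + l'.vec) ((L : ℤ) • w) (treeWord (boxVec L r))) (treeWord (boxVec L r)),
        s.1 ∈ U i w i)
    (hU : ∀ i, i < k → ∀ (w : Site d), ∀ m, m < i → ∀ z ∈ U i w (m + 1), ∀ (κ : Fin d) (r : Fin d → Fin L) (t : ℕ), t < L →
      (L : ℤ) • z + boxVec L r + (t : ℤ) • e κ ∈ U i w m)
    (hU' : ∀ i, i < k → ∀ (w : Site d), ∀ m, m < i → ∀ z ∈ U i w (m + 1), ∀ (κ : Fin d) (s : Fin d → Fin L),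
      (L : ℤ) • z + (L : ℤ) • e κ + boxVec L s ∈ U i w m) :
    ∑ z ∈ Zk, ∑ κ : Fin d, ‖Q z κ‖ ≤
      (∏ m ∈ Finset.range k, ((L : ℝ) * ((L : ℝ) ^ d)⁻¹ + 2 * d * a m)) * ∑ y ∈ Z 0, ∑ ν : Fin d, ‖G 0 y ν‖ +
        d * L * ∑ i ∈ Finset.range k, (∏ m ∈ Finset.range i, ((L : ℝ) * ((L : ℝ) ^ d)⁻¹ + 2 * d * a m)) *
          ∑ z ∈ Zk, ∑ κ : Fin d,
            (∑ x ∈ U i (((L : ℤ) ^ (k - 1 - i)) • z) 0, ∑ μ : Fin d, ‖G 0 x μ‖ +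
              ∑ x ∈ U i (((L : ℤ) ^ (k - 1 - i)) • (z + e κ)) 0, ∑ μ : Fin d, ‖G 0 x μ‖) := by
  set w : ℕ → ℝ := fun m => (L : ℝ) * ((L : ℝ) ^ d)⁻¹ + 2 * d * a m with hw
  have hpoint : ∀ z ∈ Zk, ∀ κ : Fin d, ‖Q z κ‖ ≤ ‖G k z κ‖ +
      ∑ i ∈ Finset.range k, (‖CM i (G i) (((L : ℤ) ^ (k - 1 - i)) • z)‖ + ‖CM i (G i) (((L : ℤ) ^ (k - 1 - i)) • (z + e κ))‖) := by
    intro z hz κ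
    have h1 := norm_unrolled_le L CM G Λ hΛ0 hΛs k z
    have h2 := norm_unrolled_le L CM G Λ hΛ0 hΛs k (z + e κ)
    rw [Finset.sum_add_distrib]
    linarith [hQ z hz κ]
  have hG : ∑ z ∈ Zk, ∑ κ : Fin d, ‖G k z κ‖ ≤ (∏ m ∈ Finset.range k, w m) * ∑ y ∈ Z 0, ∑ ν : Fin d, ‖G 0 y ν‖ := by
    rw [← hZk]
    exact sum_norm_tower_le_of_pointwise L hL G a ha k Z (fun m hm z _ κ => hpt m hm z κ) hZ hZ'
  -- every corner value along its localised chain, read at `L•y`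
  have hcorner : ∀ i, i < k → ∀ (y : Site d),
      ‖CM i (G i) y‖ ≤ d * L * ((∏ m ∈ Finset.range i, w m) * ∑ x ∈ U i y 0, ∑ μ : Fin d, ‖G 0 x μ‖) := by
    intro i hi y
    exact le_localised_of_steps_bound L hL G a ha i ((L : ℤ) • y) (hC i hi y) (U i y) (hUtop i hi y)
      (fun m hm z _ κ => hpt m (hm.trans hi) z κ) (hU i hi y) (hU' i hi y)
  have hΛ : ∑ z ∈ Zk, ∑ κ : Fin d, ∑ i ∈ Finset.range k, (‖CM i (G i) (((L : ℤ) ^ (k - 1 - i)) • z)‖ + ‖CM i (G i) (((L : ℤ) ^ (k - 1 - i)) • (z + e κ))‖)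
      ≤ d * L * ∑ i ∈ Finset.range k, (∏ m ∈ Finset.range i, w m) *
          ∑ z ∈ Zk, ∑ κ : Fin d,
            (∑ x ∈ U i (((L : ℤ) ^ (k - 1 - i)) • z) 0, ∑ μ : Fin d, ‖G 0 x μ‖ +
              ∑ x ∈ U i (((L : ℤ) ^ (k - 1 - i)) • (z + e κ)) 0, ∑ μ : Fin d, ‖G 0 x μ‖) := by
    have hre : ∑ z ∈ Zk, ∑ κ : Fin d, ∑ i ∈ Finset.range k, (‖CM i (G i) (((L : ℤ) ^ (k - 1 - i)) • z)‖ + ‖CM i (G i) (((L : ℤ) ^ (k - 1 - i)) • (z + e κ))‖)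
        = ∑ i ∈ Finset.range k, ∑ z ∈ Zk, ∑ κ : Fin d, (‖CM i (G i) (((L : ℤ) ^ (k - 1 - i)) • z)‖ + ‖CM i (G i) (((L : ℤ) ^ (k - 1 - i)) • (z + e κ))‖) := by
      calc ∑ z ∈ Zk, ∑ κ : Fin d, ∑ i ∈ Finset.range k, (‖CM i (G i) (((L : ℤ) ^ (k - 1 - i)) • z)‖ + ‖CM i (G i) (((L : ℤ) ^ (k - 1 - i)) • (z + e κ))‖)
          = ∑ z ∈ Zk, ∑ i ∈ Finset.range k, ∑ κ : Fin d, (‖CM i (G i) (((L : ℤ) ^ (k - 1 - i)) • z)‖ + ‖CM i (G i) (((L : ℤ) ^ (k - 1 - i)) • (z + e κ))‖) :=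
            Finset.sum_congr rfl fun z _ => Finset.sum_comm
        _ = _ := Finset.sum_comm
    rw [hre, Finset.mul_sum]
    refine Finset.sum_le_sum fun i hi => ?_
    have hi' : i < k := Finset.mem_range.mp hi
    rw [Finset.mul_sum, Finset.mul_sum]
    refine Finset.sum_le_sum fun z _ => ?_
    rw [Finset.mul_sum, Finset.mul_sum]
    refine Finset.sum_le_sum fun κ _ => ?_
    have h1 := hcorner i hi' (((L : ℤ) ^ (k - 1 - i)) • z)
    have h2 := hcorner i hi' (((L : ℤ) ^ (k - 1 - i)) • (z + e κ))
    calc ‖CM i (G i) (((L : ℤ) ^ (k - 1 - i)) • z)‖ + ‖CM i (G i) (((L : ℤ) ^ (k - 1 - i)) • (z + e κ))‖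
        ≤ d * L * ((∏ m ∈ Finset.range i, w m) * ∑ x ∈ U i (((L : ℤ) ^ (k - 1 - i)) • z) 0, ∑ μ : Fin d, ‖G 0 x μ‖) +
          d * L * ((∏ m ∈ Finset.range i, w m) * ∑ x ∈ U i (((L : ℤ) ^ (k - 1 - i)) • (z + e κ)) 0, ∑ μ : Fin d, ‖G 0 x μ‖) := add_le_add h1 h2
      _ = _ := by ring
  have hsum : ∑ z ∈ Zk, ∑ κ : Fin d, ‖Q z κ‖ ≤ ∑ z ∈ Zk, ∑ κ : Fin d, ‖G k z κ‖ +
      ∑ z ∈ Zk, ∑ κ : Fin d, ∑ i ∈ Finset.range k, (‖CM i (G i) (((L : ℤ) ^ (k - 1 - i)) • z)‖ + ‖CM i (G i) (((L : ℤ) ^ (k - 1 - i)) • (z + e κ))‖) := by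
    rw [← Finset.sum_add_distrib]
    refine Finset.sum_le_sum fun z hz => ?_
    rw [← Finset.sum_add_distrib]
    exact Finset.sum_le_sum fun κ _ => hpoint z hz κ
  linarith [hsum, hG, hΛ]

end Summit.QuantumFields.YangMills.Theorems.Prop7CornerCombL1EngineScaled
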